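import Literature.Geometry.Lorentzian.HypersurfaceRestriction
import Literature.Geometry.Lorentzian.ChartSecondFundamentalForm
import Literature.Geometry.Lorentzian.ModelDataProofs
import HarnessLib

/-!
# The second fundamental form under coordinate-identity maps between open subsets

Support file (all results proved; no definitions, no named facts), a companion of
`HypersurfaceRestriction.lean` (`secondFundamentalForm_comp_subtypeVal`: restriction to an open
subset `W ⊆ N`). Here the source reparametrisation is a map `j : U₁ → U₂` between two open subsets
of the SAME normed space `E'` which is the identity on coordinates, `(j y : E') = y` (e.g. the
inclusion of `exteriorRegion ρ` into `Kerr.slice 0 ρ₁`, two `Opens E3` with different defining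
predicates): for a map `f : U₂ → M` with a field `ν` along it,

* `curveThrough_comp_eventuallyEq` — the chart-straight curves correspond: `j ∘ c_{y,v} = c_{j y, v}`
  near `t = 0`;
* `mfderiv_comp_opensInclusion` — `d(f ∘ j)_y = df_{j y}` (`dj = id`);
* `normalDerivAlong_comp_opensInclusion`, **`secondFundamentalForm_comp_opensInclusion`** —
  `D_v(ν ∘ j) = D_v ν` and `K_{ν∘j}(f ∘ j)(y) = K_ν(f)(j y)` on `T_y U₁ = E' = T_{j y} U₂`.

References: B. O'Neill, *Semi-Riemannian Geometry* (1983), Ch. 3, p. 57 (open submanifolds) and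
Prop. 3.18; Ch. 4, pp. 98–99 and Lemma 4.4 ff.; J. M. Lee, *Introduction to Smooth Manifolds*
(2013), Prop. 3.9.
-/

noncomputable section

open Bundle Set Filter Function TopologicalSpace
open scoped Manifold ContDiff Topology

namespace Literature.Geometry.Lorentzian

namespace OpensChart

variable {E' : Type*} [NormedAddCommGroup E'] [NormedSpace ℝ E'] {U₁ U₂ : Opens E'}

/-- A coordinate-identity map between open subsets is smooth. [folklore] -/
theorem contMDiff_of_coe_eq (j : U₁ → U₂) (hj : ∀ y : U₁, (j y : E') = y) {n : WithTop ℕ∞} :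
    ContMDiff 𝓘(ℝ, E') 𝓘(ℝ, E') n j := by
  intro y
  have h1 : ContMDiffAt 𝓘(ℝ, E') 𝓘(ℝ, E') n (fun x : U₁ ↦ (j x : E')) y :=
    (contMDiffAt_iff y _ id hj).2 contDiffAt_id
  exact (ChartedSpace.liftPropWithinAt_subtypeVal_comp_iff j Set.univ y).mp h1

/-- A coordinate-identity map between open subsets is differentiable. [folklore] -/
theorem mdifferentiableAt_of_coe_eq (j : U₁ → U₂) (hj : ∀ y : U₁, (j y : E') = y) (y : U₁) :
    MDifferentiableAt 𝓘(ℝ, E') 𝓘(ℝ, E') j y :=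
  mdifferentiableAt_of_repr (Φ := id) hj differentiableAt_id

/-- **The chart-straight curves correspond under a coordinate-identity map**: near `t = 0`,
`j (c_{y,v}(t)) = c_{j y, v}(t)` (both read `y + t v` in coordinates). O'Neill 1983, Ch. 3, p. 57.
[cite: ONeill1983, Ch. 3, p. 57] -/
theorem curveThrough_comp_eventuallyEq (j : U₁ → U₂) (hj : ∀ y : U₁, (j y : E') = y) (y : U₁)
    (v : E') :
    (j ∘ curveThrough 𝓘(ℝ, E') y v) =ᶠ[𝓝 0] curveThrough 𝓘(ℝ, E') (j y) v := by
  have h1 := subtypeVal_comp_curveThrough_eventuallyEq (I' := 𝓘(ℝ, E')) (W := U₁) y v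
  have h2 := subtypeVal_comp_curveThrough_eventuallyEq (I' := 𝓘(ℝ, E')) (W := U₂) (j y) v
  rw [hj y] at h2
  filter_upwards [h1, h2] with t h1t h2t
  apply Subtype.ext
  simp only [Function.comp_apply] at h1t h2t ⊢
  rw [hj, h1t, ← h2t]

end OpensChart

namespace PseudoRiemannianMetric

variable {E : Type*} [NormedAddCommGroup E] [NormedSpace ℝ E] {H : Type*} [TopologicalSpace H]
  {I : ModelWithCorners ℝ E H} {M : Type*} [TopologicalSpace M] [ChartedSpace H M]
  [IsManifold I ∞ M] {n : ℕ∞ω}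
  {E' : Type*} [NormedAddCommGroup E'] [NormedSpace ℝ E'] {U₁ U₂ : Opens E'}
  {g : PseudoRiemannianMetric I n E (TangentSpace I : M → Type _)}

omit [IsManifold I ∞ M] in
/-- **`d(f ∘ j)_y = df_{j y}`** for a coordinate-identity map `j` (`dj = id`). O'Neill 1983, Ch. 3,
p. 57. [cite: ONeill1983, Ch. 3, p. 57] -/
theorem mfderiv_comp_opensInclusion (j : U₁ → U₂) (hj : ∀ y : U₁, (j y : E') = y) {f : U₂ → M}
    {y : U₁} (hf : MDifferentiableAt 𝓘(ℝ, E') I f (j y)) (v : E') :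
    mfderiv 𝓘(ℝ, E') I (f ∘ j) y v = mfderiv 𝓘(ℝ, E') I f (j y) v := by
  have hjd := OpensChart.mdifferentiableAt_of_coe_eq j hj y
  rw [mfderiv_comp y hf hjd]
  show mfderiv 𝓘(ℝ, E') I f (j y) (mfderiv 𝓘(ℝ, E') 𝓘(ℝ, E') j y v) = _
  rw [OpensChart.mfderiv_apply_of_coe_eq j hj y hjd v]

variable [FiniteDimensional ℝ E] [g.HasLeviCivita]

variable (g) in
/-- **Locality of `D_v ν` under a coordinate-identity reparametrisation of the source**:
`D_v (ν ∘ j) (y) = D_v ν (j y)`. O'Neill 1983, Ch. 4, pp. 98–99. [cite: ONeill1983, Ch. 4, pp. 98–99] -/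
theorem normalDerivAlong_comp_opensInclusion (j : U₁ → U₂) (hj : ∀ y : U₁, (j y : E') = y)
    (f : U₂ → M) (ν : NormalField I f) (y : U₁) (v : E') :
    g.normalDerivAlong (I' := 𝓘(ℝ, E')) (f ∘ j) (fun y ↦ ν (j y)) y v =
      g.normalDerivAlong (I' := 𝓘(ℝ, E')) f ν (j y) v := by
  unfold normalDerivAlong
  apply covariantDerivAlong_congr_of_eventuallyEq
  filter_upwards [OpensChart.curveThrough_comp_eventuallyEq j hj y v] with t ht
  simp only [Function.comp_apply] at ht ⊢
  rw [ht]

variable [FiniteDimensional ℝ E']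

variable (g) in
/-- **Locality of the second fundamental form under a coordinate-identity reparametrisation of the
source**: `K_{ν∘j}(f ∘ j)(y) = K_ν(f)(j y)` on `T_y U₁ = E' = T_{j y} U₂`. O'Neill 1983, Ch. 4,
Lemma 4.4 ff. [cite: ONeill1983, Ch. 4, Lemma 4.4 ff.] -/
theorem secondFundamentalForm_comp_opensInclusion (j : U₁ → U₂) (hj : ∀ y : U₁, (j y : E') = y)
    (f : U₂ → M) (ν : NormalField I f) (y : U₁) (hf : MDifferentiableAt 𝓘(ℝ, E') I f (j y)) :
    g.secondFundamentalForm 𝓘(ℝ, E') (f ∘ j) (fun y ↦ ν (j y)) y =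
      g.secondFundamentalForm 𝓘(ℝ, E') f ν (j y) := by
  haveI : FiniteDimensional ℝ (TangentSpace 𝓘(ℝ, E') y) := inferInstanceAs (FiniteDimensional ℝ E')
  refine (Module.finBasis ℝ (TangentSpace 𝓘(ℝ, E') y)).ext fun i ↦ LinearMap.ext fun w ↦ ?_
  have h1 := g.secondFundamentalForm_apply_basis (I' := 𝓘(ℝ, E')) (f ∘ j) (fun y ↦ ν (j y)) y i w
  have h2 := g.secondFundamentalForm_apply_basis (I' := 𝓘(ℝ, E')) f ν (j y) i w
  rw [normalDerivAlong_comp_opensInclusion g j hj f ν y,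
    mfderiv_comp_opensInclusion j hj hf] at h1
  exact h1.trans h2.symm

end PseudoRiemannianMetric

end Literature.Geometry.Lorentzian

end
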